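import Literature.Probability.RandomPlanarGeometry.RestrictionHulls
import Literature.Topology.PlaneTopology.Janiszewski
import Literature.Topology.PlaneTopology.WindingNumber
import Literature.Analysis.Complex.SimplyConnectedOfCompl
import HarnessLib

/-!
# The `±`-decomposition of a `*`-hull (Lawler–Schramm–Werner 2003, §2 p. 8)

G. F. Lawler, O. Schramm, W. Werner, *Conformal restriction: the chordal case*, J. Amer. Math.
Soc. **16** (2003) 917–955, arXiv:math/0209343 (**[LSW]**), §2 p. 8: "If `A ∈ 𝒬*`, then we can
find unique `A₁, A₃ ∈ 𝒬₊` and `A₂, A₄ ∈ 𝒬₋` such that `A = A₁ · A₂ = A₄ · A₃`" (the named fact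
`Literature.Probability.RandomPlanarGeometry.IsStarHull.exists_isHullProduct_plus_minus` of `HullApproximation`). The TOPOLOGICAL half of
this factorisation is proved here: a `*`-hull `A` (without floating pieces, i.e. with
`A ∪ {Im ≤ 0}` connected — automatic for hulls, `IsBoundedHull.isConnected_union_im_nonpos`) is the
DISJOINT union of

* `Literature.sidePart A 1`, the union of the connected components of `A` meeting `(0, ∞)`, a `+`-hull,
* `Literature.sidePart A (-1)`, the union of those meeting `(-∞, 0)`, a `−`-hull,

each again without floating pieces (`Literature.Probability.RandomPlanarGeometry.IsStarHull.sidePart_decomposition`). The analytic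
half (`A = (Φ_{A₋}(A₊)) · A₋`) is assembled with the maps of `HullUniformizer` in a sibling file.

Ingredients, all proved:

* `Literature.Probability.RandomPlanarGeometry.IsStarHull.not_arch` — **no component of `A` meets both half-axes**: if a closed connected
  `C ⊆ A` contained reals `x₁ < 0 < x₂`, then for `K = C ∪ C̄ ∌ 0` the point `0` and the far
  point `y = -(R+1)i` would lie in the same component of `ℂ ∖ K` (both are reached from the
  connected `ℍ ∖ A ⊆ ℂ ∖ K`), so `z/(z - y)`, hence `z`, would have a continuous logarithm `L` on
  `K` (`Janiszewski.exists_log_of_mem_connectedComponentIn`, the easy half of Borsuk's criterion);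
  comparing `L` with `log z` on `C ⊆ {Im ≥ 0}` and with `conj (log z̄)` on `C̄` (continuous
  logarithms there; `exists_int_eq_add_of_exp_eq`) at `x₂` and at `x₁` gives `πi = -πi`.
* `Literature.Probability.RandomPlanarGeometry.IsStarHull.exists_real_mem_connectedComponentIn` — every component of `A` meets
  `ℝ ∖ {0}`: in the compact space `A` components are quasi-components
  (`connectedComponent_eq_iInter_isClopen`), every clopen piece meets `ℝ` (no floating pieces),
  and a directed intersection of nonempty compact real traces is nonempty.
* closedness of the side parts through the compact Hausdorff space of components
  (`ConnectedComponents.t2`, `connectedComponents_preimage_image`); `ℍ ∖ A₊` is connected (a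
  bounded open set has a non-real boundary point) and has connected unbounded complement
  `A₊ ∪ {Im ≤ 0}`, so is simply connected (`Complex.isSimplyConnected_of_compl`, Conway VIII.2.2).
-/

noncomputable section

open Set Filter Topology Metric Bornology Complex
open UpperHalfPlane (upperHalfPlaneSet isOpen_upperHalfPlaneSet)
open scoped ComplexConjugate Real

namespace Literature.Probability.RandomPlanarGeometry

variable {A : Set ℂ}

/-! ### Hulls lie in the closed upper half-plane -/

/-- Points of a bounded hull have nonnegative imaginary part. [folklore] -/
theorem IsBoundedHull.im_nonneg (hA : IsBoundedHull A) {z : ℂ} (hz : z ∈ A) : 0 ≤ z.im := by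
  have := hA.subset_closure hz
  rwa [show upperHalfPlaneSet = {z : ℂ | 0 < z.im} from rfl, closure_setOf_lt_im] at this

/-- The component of a point in a closed set is closed. [folklore] -/
theorem isClosed_connectedComponentIn_of_isClosed {X : Type*} [TopologicalSpace X] {F : Set X}
    (hF : IsClosed F) (x : X) : IsClosed (connectedComponentIn F x) := by
  by_cases hx : x ∈ F
  · refine isClosed_of_closure_subset ?_
    exact isPreconnected_connectedComponentIn.closure.subset_connectedComponentIn
      (subset_closure (mem_connectedComponentIn hx))
      (closure_minimal (connectedComponentIn_subset F x) hF)
  · rw [connectedComponentIn_eq_empty hx]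
    exact isClosed_empty

/-! ### No component of a `*`-hull meets both half-axes -/

/-- **No arch over `0`.** A closed connected subset of a `*`-hull cannot contain real points of
both signs (see the module docstring for the logarithm argument). [folklore] -/
theorem IsStarHull.not_arch (hA : IsStarHull A) {C : Set ℂ} (hCA : C ⊆ A) (hC : IsPreconnected C)
    (hCc : IsClosed C) {x₁ x₂ : ℝ} (hx₁ : x₁ < 0) (hx₂ : 0 < x₂) (h₁ : (x₁ : ℂ) ∈ C)
    (h₂ : (x₂ : ℂ) ∈ C) : False := by
  have hAc : IsClosed A := hA.isBoundedHull.isClosed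
  have him : ∀ z ∈ C, 0 ≤ z.im := fun z hz ↦ hA.isBoundedHull.im_nonneg (hCA hz)
  -- the symmetric closed set `K = C ∪ conj C`
  set K : Set ℂ := C ∪ {z | conj z ∈ C} with hKdef
  have hKc : IsClosed K := hCc.union (hCc.preimage continuous_conj)
  have h0K : (0 : ℂ) ∉ K := by
    rintro (h0 | h0)
    · exact hA.zero_notMem (hCA h0)
    · rw [mem_setOf_eq, map_zero] at h0
      exact hA.zero_notMem (hCA h0)
  -- a radius bounding `A` and `K`
  obtain ⟨R₀, hR₀⟩ := hA.isBoundedHull.1.subset_closedBall 0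
  set R : ℝ := max R₀ 0 with hRdef
  have hRA : ∀ z ∈ A, ‖z‖ ≤ R := fun z hz ↦ by
    have := hR₀ hz
    rw [mem_closedBall, dist_zero_right] at this
    exact this.trans (le_max_left _ _)
  have hR0 : 0 ≤ R := le_max_right _ _
  have hRK : ∀ z ∈ K, ‖z‖ ≤ R := by
    rintro z (hz | hz)
    · exact hRA z (hCA hz)
    · have := hRA _ (hCA hz)
      rwa [norm_conj] at this
  -- `ℍ ∖ A ⊆ Kᶜ`
  have hUK : upperHalfPlaneSet \ A ⊆ Kᶜ := by
    rintro z ⟨hzH, hzA⟩ (hz | hz)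
    · exact hzA (hCA hz)
    · have := him _ hz
      rw [conj_im] at this
      have hzH' : 0 < z.im := hzH
      linarith
  -- the far point `y`
  set y : ℂ := -((R + 1 : ℝ) : ℂ) * I with hydef
  have hyim : y.im = -(R + 1) := by simp [hydef]
  have hynorm : ‖y‖ = R + 1 := by
    rw [hydef, norm_mul, norm_neg, norm_real, norm_I, mul_one, Real.norm_of_nonneg (by linarith)]
  -- `0` and `y` lie in the same component of `Kᶜ`
  have hy : y ∈ connectedComponentIn Kᶜ 0 := by
    -- a small ball about `0` off `K` and off `A`
    obtain ⟨ε, hε, hball⟩ : ∃ ε > 0, ball (0 : ℂ) ε ⊆ Kᶜ ∩ Aᶜ :=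
      Metric.isOpen_iff.1 (hKc.isOpen_compl.inter hAc.isOpen_compl) 0 ⟨h0K, hA.zero_notMem⟩
    set z₁ : ℂ := ((ε / 2 : ℝ) : ℂ) * I with hz₁
    have hz₁ball : z₁ ∈ ball (0 : ℂ) ε := by
      rw [mem_ball_zero_iff, hz₁, norm_mul, norm_real, norm_I, mul_one, Real.norm_of_nonneg (by linarith)]
      linarith
    have hz₁U : z₁ ∈ upperHalfPlaneSet \ A :=
      ⟨show 0 < z₁.im by simp [hz₁]; linarith, (hball hz₁ball).2⟩
    have h01 : z₁ ∈ connectedComponentIn Kᶜ 0 :=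
      (convex_ball (0 : ℂ) ε).isPreconnected.subset_connectedComponentIn (mem_ball_self hε)
        (hball.trans inter_subset_left) hz₁ball
    -- the connected `ℍ ∖ A` joins `z₁` to `z₂ = (R+1) i`
    set z₂ : ℂ := ((R + 1 : ℝ) : ℂ) * I with hz₂
    have hz₂norm : ‖z₂‖ = R + 1 := by
      rw [hz₂, norm_mul, norm_real, norm_I, mul_one, Real.norm_of_nonneg (by linarith)]
    have hz₂U : z₂ ∈ upperHalfPlaneSet \ A :=
      ⟨show 0 < z₂.im by simp [hz₂]; linarith, fun h ↦ by linarith [hRA _ h]⟩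
    have hU : IsPreconnected (upperHalfPlaneSet \ A) :=
      hA.1.2.2.isPathConnected.isConnected.isPreconnected
    have h02 : z₂ ∈ connectedComponentIn Kᶜ 0 := by
      rw [connectedComponentIn_eq h01]
      exact hU.subset_connectedComponentIn hz₁U hUK hz₂U
    -- the connected exterior joins `z₂` to `y`
    have hE : IsPreconnected {z : ℂ | R < ‖z‖} := (Literature.Topology.PlaneTopology.isConnected_setOf_lt_norm hR0).isPreconnected
    have hEK : {z : ℂ | R < ‖z‖} ⊆ Kᶜ := fun z hz hzK ↦ by
      have := hRK z hzK
      simp only [mem_setOf_eq] at hz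
      linarith
    rw [connectedComponentIn_eq h02]
    exact hE.subset_connectedComponentIn (show R < ‖z₂‖ by rw [hz₂norm]; linarith) hEK
      (show R < ‖y‖ by rw [hynorm]; linarith)
  -- hence `z ↦ z` has a continuous logarithm `L` on `K`
  obtain ⟨g, hgc, hg⟩ := Literature.Topology.PlaneTopology.Janiszewski.exists_log_of_mem_connectedComponentIn hKc hy
  have hslit : ∀ z ∈ K, z - y ∈ slitPlane := fun z hz ↦ by
    refine mem_slitPlane_iff.2 (Or.inr ?_)
    have h1 : |z.im| ≤ ‖z‖ := abs_im_le_norm z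
    have h2 := hRK z hz
    rw [sub_im, hyim]
    have : -R ≤ z.im := by linarith [neg_abs_le z.im]
    linarith
  have hzy : ∀ z ∈ K, z - y ≠ 0 := fun z hz ↦ slitPlane_ne_zero (hslit z hz)
  set L : ℂ → ℂ := fun z ↦ g z + log (z - y) with hLdef
  have hLc : ContinuousOn L K := hgc.add fun z hz ↦ by
    have h1 : ContinuousAt (fun w : ℂ ↦ w - y) z := continuousAt_id.sub continuousAt_const
    exact (ContinuousAt.comp (x := z) (continuousAt_clog (hslit z hz)) h1).continuousWithinAt
  have hL : ∀ z ∈ K, exp (L z) = z := fun z hz ↦ by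
    rw [hLdef, exp_add, hg z hz, exp_log (hzy z hz), sub_zero, div_mul_cancel₀ _ (hzy z hz)]
  -- on `C`, `L = log + 2πi n`
  have h0C : ∀ z ∈ C, z ≠ 0 := fun z hz hz0 ↦ h0K (Or.inl (hz0 ▸ hz))
  have hlogC : ContinuousOn log C := fun z hz ↦ by
    by_cases hsl : z ∈ slitPlane
    · exact (continuousAt_clog hsl).continuousWithinAt
    · rw [mem_slitPlane_iff, not_or, not_lt, not_ne_iff] at hsl
      have hre : z.re < 0 := lt_of_le_of_ne hsl.1 fun h0 ↦ h0C z hz (Complex.ext h0 hsl.2)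
      exact (continuousWithinAt_log_of_re_neg_of_im_zero hre hsl.2).mono fun w hw ↦ him w hw
  obtain ⟨n, hn⟩ := Literature.Topology.PlaneTopology.exists_int_eq_add_of_exp_eq hC (hLc.mono subset_union_left) hlogC
    (fun z hz ↦ by rw [hL z (Or.inl hz), exp_log (h0C z hz)])
  -- on `conj C`, `L = conj ∘ log ∘ conj + 2πi m`
  set C' : Set ℂ := {z | conj z ∈ C} with hC'def
  have hC'eq : C' = conj '' C := by
    ext z
    refine ⟨fun hz ↦ ⟨conj z, hz, conj_conj z⟩, ?_⟩
    rintro ⟨w, hw, rfl⟩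
    simpa [hC'def] using hw
  have hC' : IsPreconnected C' := by
    rw [hC'eq]
    exact hC.image _ continuous_conj.continuousOn
  set ℓ : ℂ → ℂ := fun z ↦ conj (log (conj z)) with hℓdef
  have hℓc : ContinuousOn ℓ C' := by
    refine (continuous_conj.continuousOn.comp (hlogC.comp continuous_conj.continuousOn fun z hz ↦ hz)
      (mapsTo_univ _ _))
  have hℓ : ∀ z ∈ C', exp (ℓ z) = z := fun z hz ↦ by
    rw [hℓdef, exp_conj, exp_log (h0C _ hz), conj_conj]
  obtain ⟨m, hm⟩ := Literature.Topology.PlaneTopology.exists_int_eq_add_of_exp_eq hC' (hLc.mono subset_union_right) hℓc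
    (fun z hz ↦ by rw [hL z (Or.inr hz), hℓ z hz])
  -- compare at `x₂ > 0`: `n = m`
  have hx₂C' : (x₂ : ℂ) ∈ C' := by simpa [hC'def] using h₂
  have hlog₂ : log (x₂ : ℂ) = (Real.log x₂ : ℂ) := (ofReal_log hx₂.le).symm
  have hℓ₂ : ℓ x₂ = (Real.log x₂ : ℂ) := by
    rw [hℓdef]
    simp only [conj_ofReal, hlog₂]
  have hnm : n = m := by
    have e1 := hn _ h₂
    have e2 := hm _ hx₂C'
    rw [hlog₂] at e1
    rw [hℓ₂] at e2
    exact Literature.Topology.PlaneTopology.int_eq_of_mul_two_pi_I_eq (add_left_cancel (e1.symm.trans e2))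
  -- compare at `x₁ < 0`: `π = -π`
  have hx₁C' : (x₁ : ℂ) ∈ C' := by simpa [hC'def] using h₁
  have hlog₁ : (log (x₁ : ℂ)).im = π := by rw [log_im, arg_ofReal_of_neg hx₁]
  have hℓ₁ : (ℓ x₁).im = -π := by
    rw [hℓdef]
    simp only [conj_ofReal, conj_im, log_im, arg_ofReal_of_neg hx₁]
  have key : log (x₁ : ℂ) = ℓ x₁ := by
    have := (hn _ h₁).symm.trans (hm _ hx₁C')
    rw [hnm] at this
    exact add_right_cancel this
  have := congrArg Complex.im key
  rw [hlog₁, hℓ₁] at this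
  linarith [Real.pi_pos]

/-! ### Every component of a hull meets the real axis -/

/-- **No floating components.** If `A ∪ {Im ≤ 0}` is connected (`A` closed and bounded, in the
closed upper half-plane, `0 ∉ A`), every connected component of `A` contains a nonzero real
point: in the compact space `A` components are quasi-components, each clopen piece meets `ℝ`,
and a directed intersection of nonempty compact real traces is nonempty. [folklore] -/
theorem IsStarHull.exists_real_mem_connectedComponentIn (hA : IsStarHull A)
    (hnf : IsConnected (A ∪ {z : ℂ | z.im ≤ 0})) {a : ℂ} (ha : a ∈ A) :
    ∃ x : ℝ, x ≠ 0 ∧ (x : ℂ) ∈ connectedComponentIn A a := by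
  have hAc : IsClosed A := hA.isBoundedHull.isClosed
  have hAcpt : IsCompact A := hA.isBoundedHull.isCompact
  haveI : CompactSpace A := isCompact_iff_compactSpace.1 hAcpt
  have him : ∀ z ∈ A, 0 ≤ z.im := fun z hz ↦ hA.isBoundedHull.im_nonneg hz
  -- the real trace of `A`, in the subtype
  set Rl : Set A := {s : A | (s : ℂ).im = 0} with hRl
  have hRlc : IsClosed Rl := isClosed_eq (continuous_im.comp continuous_subtype_val) continuous_const
  -- every clopen `Z ∋ ⟨a, ha⟩` meets `Rl`
  have hclopen : ∀ Z : Set A, IsClopen Z → (⟨a, ha⟩ : A) ∈ Z → (Z ∩ Rl).Nonempty := by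
    intro Z hZ haZ
    by_contra hno
    rw [not_nonempty_iff_eq_empty] at hno
    -- `Z' = ↑Z` is clopen in `A`, misses `ℝ`
    set Z' : Set ℂ := ((↑) : A → ℂ) '' Z with hZ'
    have hZ'c : IsClosed Z' := hAc.isClosedEmbedding_subtypeVal.isClosedMap _ hZ.1
    have hW'c : IsClosed (((↑) : A → ℂ) '' Zᶜ) :=
      hAc.isClosedEmbedding_subtypeVal.isClosedMap _ hZ.2.isClosed_compl
    have hZ'A : Z' ⊆ A := by rintro _ ⟨s, -, rfl⟩; exact s.2
    have hZ'im : ∀ z ∈ Z', 0 < z.im := by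
      rintro _ ⟨s, hs, rfl⟩
      rcases (him _ s.2).lt_or_eq with hlt | heq
      · exact hlt
      · exfalso
        have : s ∈ Z ∩ Rl := ⟨hs, heq.symm⟩
        rw [hno] at this
        exact this
    have hcover : A ∪ {z : ℂ | z.im ≤ 0} ⊆ Z' ∪ (((↑) : A → ℂ) '' Zᶜ ∪ {z : ℂ | z.im ≤ 0}) := by
      rintro z (hz | hz)
      · by_cases hzZ : (⟨z, hz⟩ : A) ∈ Z
        · exact Or.inl ⟨⟨z, hz⟩, hzZ, rfl⟩
        · exact Or.inr (Or.inl ⟨⟨z, hz⟩, hzZ, rfl⟩)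
      · exact Or.inr (Or.inr hz)
    have hpre := hnf.isPreconnected
    rw [isPreconnected_iff_subset_of_disjoint_closed] at hpre
    have hLc : IsClosed {z : ℂ | z.im ≤ 0} := isClosed_le continuous_im continuous_const
    rcases hpre Z' _ hZ'c (hW'c.union hLc) hcover (by
      rw [← subset_empty_iff]
      rintro z ⟨-, hzZ', hzW | hzL⟩
      · obtain ⟨s, hs, rfl⟩ := hzZ'
        obtain ⟨t, ht, hts⟩ := hzW
        have : t = s := Subtype.ext hts
        exact ht (this ▸ hs)
      · exact absurd (hZ'im z hzZ') (not_lt.2 hzL)) with h1 | h1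
    · have hmem : (-I : ℂ) ∈ Z' := h1 (Or.inr (by simp))
      have := hZ'im _ hmem
      simp only [neg_im, I_im] at this
      linarith
    · have haZ' : a ∈ Z' := ⟨⟨a, ha⟩, haZ, rfl⟩
      rcases h1 (Or.inl ha) with h2 | h2
      · obtain ⟨t, ht, hta⟩ := h2
        have : t = ⟨a, ha⟩ := Subtype.ext hta
        exact ht (this ▸ haZ)
      · exact absurd (hZ'im a haZ') (not_lt.2 h2)
  -- the quasi-component of `⟨a, ha⟩` is its component; intersect with `Rl`
  set ι := {Z : Set A // IsClopen Z ∧ (⟨a, ha⟩ : A) ∈ Z}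
  have hcomp : connectedComponent (⟨a, ha⟩ : A) = ⋂ Z : ι, (Z : Set A) :=
    connectedComponent_eq_iInter_isClopen _
  have hdir : Directed (· ⊇ ·) fun Z : ι ↦ (Z : Set A) ∩ Rl := by
    intro Z₁ Z₂
    refine ⟨⟨Z₁.1 ∩ Z₂.1, Z₁.2.1.inter Z₂.2.1, Z₁.2.2, Z₂.2.2⟩, ?_, ?_⟩
    · exact inter_subset_inter_left _ inter_subset_left
    · exact inter_subset_inter_left _ inter_subset_right
  haveI : Nonempty ι := ⟨⟨univ, isClopen_univ, mem_univ _⟩⟩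
  have hne : (⋂ Z : ι, (Z : Set A) ∩ Rl).Nonempty :=
    IsCompact.nonempty_iInter_of_directed_nonempty_isCompact_isClosed _ hdir
      (fun Z ↦ hclopen Z.1 Z.2.1 Z.2.2) (fun Z ↦ (Z.2.1.isClosed.inter hRlc).isCompact)
      (fun Z ↦ Z.2.1.isClosed.inter hRlc)
  obtain ⟨s, hs⟩ := hne
  rw [mem_iInter] at hs
  have hsc : s ∈ connectedComponent (⟨a, ha⟩ : A) := by
    rw [hcomp, mem_iInter]
    exact fun Z ↦ (hs Z).1
  have hsR : (s : ℂ).im = 0 := (hs (Classical.arbitrary ι)).2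
  refine ⟨(s : ℂ).re, fun h0 ↦ hA.zero_notMem ?_, ?_⟩
  · have : (s : ℂ) = 0 := Complex.ext (by simp [h0]) (by simp [hsR])
    exact this ▸ s.2
  · have hsre : (((s : ℂ).re : ℝ) : ℂ) = s := Complex.ext (by simp) (by simp [hsR])
    rw [hsre, connectedComponentIn_eq_image ha]
    exact ⟨s, hsc, rfl⟩

/-! ### The side parts of a `*`-hull -/

/-- **The side part `A_s`** of `A` (`s = 1`: the `+`-part, `s = -1`: the `−`-part): the union of
the connected components of `A` containing a real point `x` with `s x > 0`.
[cite: LawlerSchrammWerner2003Restriction, §2 p. 8 (±-hulls, A = A₁ · A₂)] -/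
def sidePart (A : Set ℂ) (s : ℝ) : Set ℂ :=
  {a | a ∈ A ∧ ∃ x : ℝ, 0 < s * x ∧ (x : ℂ) ∈ connectedComponentIn A a}

variable {s : ℝ}

/-- `A_s ⊆ A`. [folklore] -/
theorem sidePart_subset (A : Set ℂ) (s : ℝ) : sidePart A s ⊆ A := fun _ ha ↦ ha.1

/-- `A_s` is a union of components of `A`. [folklore] -/
theorem connectedComponentIn_subset_sidePart {a : ℂ} (ha : a ∈ sidePart A s) :
    connectedComponentIn A a ⊆ sidePart A s := fun b hb ↦ by
  obtain ⟨-, x, hx, hxa⟩ := ha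
  refine ⟨connectedComponentIn_subset _ _ hb, x, hx, ?_⟩
  rwa [← connectedComponentIn_eq hb]

/-- A real point `x ∈ A` with `s x > 0` lies in `A_s`. [folklore] -/
theorem ofReal_mem_sidePart {x : ℝ} (hx : 0 < s * x) (hxA : (x : ℂ) ∈ A) : (x : ℂ) ∈ sidePart A s :=
  ⟨hxA, x, hx, mem_connectedComponentIn hxA⟩

/-- Every point of `A_s` lies in a connected subset of `A_s` containing a real `x` with
`s x > 0` (its component). [folklore] -/
theorem exists_isPreconnected_of_mem_sidePart {a : ℂ} (ha : a ∈ sidePart A s) :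
    ∃ C ⊆ sidePart A s, IsPreconnected C ∧ a ∈ C ∧ ∃ x : ℝ, 0 < s * x ∧ (x : ℂ) ∈ C :=
  ⟨connectedComponentIn A a, connectedComponentIn_subset_sidePart ha,
    isPreconnected_connectedComponentIn, mem_connectedComponentIn ha.1, ha.2⟩

namespace IsStarHull

variable (hA : IsStarHull A) (hnf : IsConnected (A ∪ {z : ℂ | z.im ≤ 0}))
include hA

/-- Real points `x, x'` of one component of a `*`-hull have the same sign. [folklore] -/
theorem sign_eq_of_mem_connectedComponentIn {a : ℂ} {x x' : ℝ} (hx : 0 < s * x)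
    (hxa : (x : ℂ) ∈ connectedComponentIn A a) (hx'a : (x' : ℂ) ∈ connectedComponentIn A a)
    (hx'0 : x' ≠ 0) : 0 < s * x' := by
  have hC := isPreconnected_connectedComponentIn (F := A) (x := a)
  have hCc := isClosed_connectedComponentIn_of_isClosed hA.isBoundedHull.isClosed a
  have hCA := connectedComponentIn_subset A a
  have hx0 : x ≠ 0 := by rintro rfl; simp at hx
  by_contra hle
  push Not at hle
  have hlt : s * x' < 0 := lt_of_le_of_ne hle (mul_ne_zero (by rintro rfl; simp at hx) hx'0)
  have h3 : (s * s) * (x * x') < 0 := by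
    have := mul_neg_of_pos_of_neg hx hlt
    have e : s * x * (s * x') = (s * s) * (x * x') := by ring
    linarith
  have hopp : x * x' < 0 := neg_of_mul_neg_right h3 (mul_self_nonneg s)
  rcases lt_or_gt_of_ne hx0 with h | h
  · have hx' : 0 < x' := by
      by_contra hle'
      push Not at hle'
      nlinarith
    exact hA.not_arch hCA hC hCc h hx' hxa hx'a
  · have hx' : x' < 0 := by
      by_contra hle'
      push Not at hle'
      nlinarith
    exact hA.not_arch hCA hC hCc hx' h hx'a hxa

include hnf

/-- `A = A_s ∪ A_{-s}` (every component meets `ℝ ∖ {0}`). [folklore] -/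
theorem sidePart_union (hs : s ≠ 0) : sidePart A s ∪ sidePart A (-s) = A := by
  refine Subset.antisymm (union_subset (sidePart_subset A s) (sidePart_subset A _)) fun a ha ↦ ?_
  obtain ⟨x, hx0, hxa⟩ := hA.exists_real_mem_connectedComponentIn hnf ha
  rcases lt_or_gt_of_ne (mul_ne_zero hs hx0) with h | h
  · exact Or.inr ⟨ha, x, by linarith, hxa⟩
  · exact Or.inl ⟨ha, x, h, hxa⟩

omit hnf in
/-- `A_s ∩ A_{-s} = ∅` (no component meets both half-axes). [folklore] -/
theorem disjoint_sidePart : Disjoint (sidePart A s) (sidePart A (-s)) := by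
  refine Set.disjoint_left.2 fun a ⟨_, x, hx, hxa⟩ ⟨_, x', hx', hx'a⟩ ↦ ?_
  have hx'0 : x' ≠ 0 := by rintro rfl; simp at hx'
  have := hA.sign_eq_of_mem_connectedComponentIn hx hxa hx'a hx'0
  linarith

omit hnf in
/-- The real points `x` of `A_s` satisfy `s x > 0`. [folklore] -/
theorem pos_of_ofReal_mem_sidePart {x : ℝ} (hx : (x : ℂ) ∈ sidePart A s) : 0 < s * x := by
  obtain ⟨hxA, x', hx', hx'a⟩ := hx
  have hx0 : x ≠ 0 := by
    rintro rfl
    exact hA.zero_notMem (by simpa using hxA)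
  exact hA.sign_eq_of_mem_connectedComponentIn hx' hx'a (mem_connectedComponentIn hxA) hx0

omit hnf in
/-- **`A_s` is closed**: it is the preimage of the compact image of the closed real trace
`{Im = 0, s·Re ≥ 0}` in the Hausdorff space of components of the compact space `A`. [folklore] -/
theorem isClosed_sidePart (hs : s ≠ 0) : IsClosed (sidePart A s) := by
  have hAc : IsClosed A := hA.isBoundedHull.isClosed
  haveI : CompactSpace A := isCompact_iff_compactSpace.1 hA.isBoundedHull.isCompact
  set P : Set A := {t : A | (t : ℂ).im = 0 ∧ 0 ≤ s * (t : ℂ).re} with hP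
  have hPc : IsClosed P :=
    (isClosed_eq (continuous_im.comp continuous_subtype_val) continuous_const).inter
      (isClosed_le continuous_const (continuous_const.mul (continuous_re.comp continuous_subtype_val)))
  set Q : Set A := ConnectedComponents.mk ⁻¹' (ConnectedComponents.mk '' P) with hQ
  have hQc : IsClosed Q :=
    ((hPc.isCompact.image ConnectedComponents.continuous_coe).isClosed).preimage
      ConnectedComponents.continuous_coe
  have hQeq : Q = ⋃ t ∈ P, connectedComponent t := connectedComponents_preimage_image P
  have heq : sidePart A s = ((↑) : A → ℂ) '' Q := by
    ext a
    constructor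
    · rintro ⟨ha, x, hx, hxa⟩
      rw [connectedComponentIn_eq_image ha] at hxa
      obtain ⟨t, ht, htx⟩ := hxa
      refine ⟨⟨a, ha⟩, ?_, rfl⟩
      rw [hQeq, mem_iUnion₂]
      refine ⟨t, ⟨by rw [htx, ofReal_im], ?_⟩, ?_⟩
      · rw [htx, ofReal_re]; exact hx.le
      · rw [← connectedComponent_eq ht]
        exact mem_connectedComponent
    · rintro ⟨a', ha', rfl⟩
      rw [hQeq, mem_iUnion₂] at ha'
      obtain ⟨t, ⟨htim, htre⟩, hat⟩ := ha'
      have htre' : (((t : ℂ).re : ℝ) : ℂ) = t := Complex.ext (by simp) (by simp [htim])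
      have ht0 : (t : ℂ).re ≠ 0 := fun h0 ↦ hA.zero_notMem (by
        have : (t : ℂ) = 0 := Complex.ext (by simp [h0]) (by simp [htim])
        exact this ▸ t.2)
      refine ⟨a'.2, (t : ℂ).re, lt_of_le_of_ne htre (mul_ne_zero hs ht0).symm, ?_⟩
      rw [connectedComponentIn_eq_image a'.2, htre']
      refine ⟨t, ?_, rfl⟩
      show t ∈ connectedComponent a'
      rw [← connectedComponent_eq hat]
      exact mem_connectedComponent
  rw [heq]
  exact hAc.isClosedEmbedding_subtypeVal.isClosedMap _ hQc

/-- `A_s = cl(A_s ∩ ℍ)`. [folklore] -/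
theorem closure_sidePart_inter (hs : s ≠ 0) :
    closure (sidePart A s ∩ upperHalfPlaneSet) = sidePart A s := by
  refine Subset.antisymm (closure_minimal inter_subset_left (hA.isClosed_sidePart hs)) fun a ha ↦ ?_
  have hO : IsOpen (sidePart A (-s))ᶜ := (hA.isClosed_sidePart (neg_ne_zero.2 hs)).isOpen_compl
  have haO : a ∈ (sidePart A (-s))ᶜ := fun h ↦ Set.disjoint_left.1 hA.disjoint_sidePart ha h
  have hacl : a ∈ closure (A ∩ upperHalfPlaneSet) := by
    rw [hA.isBoundedHull.closure_inter_eq]; exact ha.1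
  have h1 := hO.inter_closure ⟨haO, hacl⟩
  refine closure_mono ?_ h1
  rintro z ⟨hzO, hzA, hzH⟩
  refine ⟨?_, hzH⟩
  have := (hA.sidePart_union hnf hs).symm.subset hzA
  exact this.resolve_right hzO

omit hA hnf in
/-- **`A_s ∪ {Im ≤ 0}` is connected** (each component of `A_s` meets the real axis). [folklore] -/
theorem isConnected_sidePart_union : IsConnected (sidePart A s ∪ {z : ℂ | z.im ≤ 0}) := by
  set L : Set ℂ := {z : ℂ | z.im ≤ 0} with hL
  have hLc : IsPreconnected L := (convex_halfSpace_im_le 0).isPreconnected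
  refine ⟨⟨0, Or.inr (by simp [hL])⟩, ?_⟩
  rcases (sidePart A s).eq_empty_or_nonempty with he | hne
  · rw [he, empty_union]; exact hLc
  have heq : sidePart A s ∪ L = ⋃ a : sidePart A s, (connectedComponentIn A a ∪ L) := by
    refine Subset.antisymm ?_ (iUnion_subset fun a ↦ union_subset_union_left _
      (connectedComponentIn_subset_sidePart a.2))
    rintro z (hz | hz)
    · exact mem_iUnion.2 ⟨⟨z, hz⟩, Or.inl (mem_connectedComponentIn hz.1)⟩
    · obtain ⟨a, ha⟩ := hne
      exact mem_iUnion.2 ⟨⟨a, ha⟩, Or.inr hz⟩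
  rw [heq]
  refine isPreconnected_iUnion ⟨0, mem_iInter.2 fun a ↦ Or.inr (by simp [hL])⟩ fun a ↦ ?_
  obtain ⟨-, x, -, hxa⟩ := a.2
  exact isPreconnected_connectedComponentIn.union' ⟨x, hxa, by simp [hL]⟩ hLc

/-- **`ℍ ∖ A_s` is connected**: it contains the connected `ℍ ∖ A`, and a component of it missing
`ℍ ∖ A` would be a bounded open subset of `A_{-s}`, whose topmost point on a vertical line would
be a point of `ℍ ∩ A_{-s}` in the closure of the component but outside it — impossible for a
component of an open set. [folklore] -/
theorem isConnected_diff_sidePart (hs : s ≠ 0) : IsConnected (upperHalfPlaneSet \ sidePart A s) := by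
  set S := sidePart A s with hSdef
  set S' := sidePart A (-s) with hS'def
  set O := upperHalfPlaneSet \ S with hOdef
  have hOo : IsOpen O := isOpen_upperHalfPlaneSet.sdiff (hA.isClosed_sidePart hs)
  have hS'c : IsClosed S' := hA.isClosed_sidePart (neg_ne_zero.2 hs)
  have hU : IsConnected (upperHalfPlaneSet \ A) := hA.1.2.2.isPathConnected.isConnected
  have hUO : upperHalfPlaneSet \ A ⊆ O := fun z hz ↦ ⟨hz.1, fun h ↦ hz.2 h.1⟩
  obtain ⟨u₀, hu₀⟩ := hU.nonempty
  set W := connectedComponentIn O u₀ with hWdef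
  have hUW : upperHalfPlaneSet \ A ⊆ W := hU.isPreconnected.subset_connectedComponentIn hu₀ hUO
  -- bound on `A`
  obtain ⟨M, hM⟩ := hA.isBoundedHull.1.subset_closedBall 0
  have hMA : ∀ w ∈ A, ‖w‖ ≤ M := fun w hw ↦ by
    have := hM hw; rwa [mem_closedBall, dist_zero_right] at this
  refine ⟨⟨u₀, hUO hu₀⟩, ?_⟩
  suffices hOW : O ⊆ W by
    have : O = W := Subset.antisymm hOW (connectedComponentIn_subset _ _)
    rw [this]; exact isPreconnected_connectedComponentIn
  intro z hz
  by_contra hzW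
  set V := connectedComponentIn O z with hVdef
  have hVo : IsOpen V := hOo.connectedComponentIn
  have hzV : z ∈ V := mem_connectedComponentIn hz
  -- `V` misses `ℍ ∖ A`, hence `V ⊆ S'`
  have hVU : ∀ v ∈ V, v ∉ upperHalfPlaneSet \ A := fun v hvV hvU ↦ by
    have h1 : W = connectedComponentIn O v := connectedComponentIn_eq (hUW hvU)
    have h2 : V = connectedComponentIn O v := connectedComponentIn_eq hvV
    exact hzW (by rw [h1, ← h2]; exact hzV)
  have hVS' : V ⊆ S' := fun v hv ↦ by
    have hvO : v ∈ O := connectedComponentIn_subset _ _ hv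
    have hvA : v ∈ A := by
      by_contra hvA
      exact hVU v hv ⟨hvO.1, hvA⟩
    have := (hA.sidePart_union hnf hs).symm.subset hvA
    exact this.resolve_left hvO.2
  -- the vertical ray from `z`
  set f : ℝ → ℂ := fun t ↦ z + t * I with hf
  have hfc : Continuous f := by rw [hf]; fun_prop
  have hfim : ∀ t, (f t).im = z.im + t := fun t ↦ by simp [hf]
  have hfnorm : ∀ t, 0 ≤ t → t - ‖z‖ ≤ ‖f t‖ := fun t ht ↦ by
    have h1 : ‖(t : ℂ) * I‖ = t := by
      rw [norm_mul, norm_real, norm_I, mul_one, Real.norm_of_nonneg ht]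
    have h2 := norm_sub_norm_le ((t : ℂ) * I) (-z)
    rw [h1, norm_neg, sub_neg_eq_add, add_comm] at h2
    exact h2
  set t₁ : ℝ := M + ‖z‖ + 1 with ht₁
  have ht₁0 : 0 ≤ t₁ := by
    have : 0 ≤ M := (norm_nonneg _).trans (hMA _ (hVS' hzV).1)
    rw [ht₁]; positivity
  have hft₁ : f t₁ ∉ V := fun h ↦ by
    have h1 := hMA _ (hVS' h).1
    have h2 := hfnorm t₁ ht₁0
    rw [ht₁] at h2
    linarith
  set D : Set ℝ := {t | t ∈ Icc 0 t₁ ∧ f t ∈ V} with hD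
  have hD0 : (0 : ℝ) ∈ D := ⟨⟨le_rfl, ht₁0⟩, by simpa [hf] using hzV⟩
  have hDbdd : BddAbove D := ⟨t₁, fun t ht ↦ ht.1.2⟩
  set τ := sSup D with hτ
  have hτmem : τ ∈ closure D := csSup_mem_closure ⟨0, hD0⟩ hDbdd
  have hτ0 : 0 ≤ τ := le_csSup hDbdd hD0
  have hτ1 : τ ≤ t₁ := csSup_le ⟨0, hD0⟩ fun t ht ↦ ht.1.2
  -- `f τ ∈ closure V`
  have hfτcl : f τ ∈ closure V := by
    have h1 : f τ ∈ closure (f '' D) :=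
      image_closure_subset_closure_image hfc ⟨τ, hτmem, rfl⟩
    exact closure_mono (by rintro _ ⟨t, ht, rfl⟩; exact ht.2) h1
  -- `f τ ∉ V`
  have hfτV : f τ ∉ V := fun hin ↦ by
    rcases hτ1.lt_or_eq with hlt | heq
    · obtain ⟨δ, hδ, hball⟩ := Metric.isOpen_iff.1 hVo _ hin
      set t' := min t₁ (τ + δ / 2) with ht'
      have ht'τ : τ < t' := lt_min hlt (by linarith)
      have ht'D : t' ∈ D := by
        refine ⟨⟨hτ0.trans ht'τ.le, min_le_left _ _⟩, hball ?_⟩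
        rw [mem_ball, dist_eq_norm]
        have : f t' - f τ = ((t' - τ : ℝ) : ℂ) * I := by simp [hf]; ring
        rw [this, norm_mul, norm_real, norm_I, mul_one, Real.norm_of_nonneg (by linarith)]
        have := min_le_right t₁ (τ + δ / 2)
        linarith
      have := le_csSup hDbdd ht'D
      linarith
    · exact hft₁ (heq ▸ hin)
  -- `w = f τ` lies in `S' ∩ ℍ ⊆ O`, so in `V` after all
  have hwS' : f τ ∈ S' := closure_minimal hVS' hS'c hfτcl
  have hwO : f τ ∈ O := by
    refine ⟨?_, fun hS ↦ Set.disjoint_left.1 hA.disjoint_sidePart hS hwS'⟩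
    show 0 < (f τ).im
    rw [hfim]
    have : 0 < z.im := hz.1
    linarith
  have hins : insert (f τ) V ⊆ V := by
    have hpre : IsPreconnected (insert (f τ) V) :=
      isPreconnected_connectedComponentIn.subset_closure (subset_insert _ _)
        (insert_subset hfτcl subset_closure)
    have := hpre.subset_connectedComponentIn (mem_insert_of_mem _ hzV)
      (insert_subset hwO (connectedComponentIn_subset _ _))
    rwa [← hVdef] at this
  exact hfτV (hins (mem_insert _ _))

/-- **`ℍ ∖ A_s` is simply connected** (connected, open, with connected unbounded complement
`A_s ∪ {Im ≤ 0}`; `Complex.isSimplyConnected_of_compl`). [folklore] -/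
theorem isSimplyConnected_diff_sidePart (hs : s ≠ 0) :
    IsSimplyConnected (upperHalfPlaneSet \ sidePart A s) := by
  have hcompl : (upperHalfPlaneSet \ sidePart A s)ᶜ = sidePart A s ∪ {z : ℂ | z.im ≤ 0} := by
    ext z
    rw [mem_compl_iff, Set.mem_sdiff, mem_union, not_and, not_not]
    constructor
    · intro h
      by_cases hz : (0 : ℝ) < z.im
      · exact Or.inl (h hz)
      · exact Or.inr (not_lt.1 hz)
    · rintro (h | h)
      · exact fun _ ↦ h
      · exact fun hz ↦ absurd (show (0 : ℝ) < z.im from hz) (not_lt.2 h)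
  refine Complex.isSimplyConnected_of_compl (isOpen_upperHalfPlaneSet.sdiff (hA.isClosed_sidePart hs))
    (hA.isConnected_diff_sidePart hnf hs) fun a ha hb ↦ ?_
  rw [hcompl] at ha hb
  have hsub : {z : ℂ | z.im ≤ 0} ⊆ connectedComponentIn (sidePart A s ∪ {z : ℂ | z.im ≤ 0}) a :=
    subset_union_right.trans ((isConnected_sidePart_union (A := A) (s := s)).isPreconnected.subset_connectedComponentIn
      ha subset_rfl)
  obtain ⟨R, hR⟩ := (hb.subset hsub).subset_closedBall 0
  have hmem : (-((|R| + 1 : ℝ) : ℂ) * I) ∈ {z : ℂ | z.im ≤ 0} := by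
    show (-((|R| + 1 : ℝ) : ℂ) * I).im ≤ 0
    simp only [neg_mul, neg_im, mul_im, ofReal_re, I_im, mul_one, ofReal_im, I_re, mul_zero, add_zero]
    linarith [abs_nonneg R]
  have := hR hmem
  rw [mem_closedBall_zero_iff, norm_mul, norm_neg, norm_real, norm_I, mul_one,
    Real.norm_of_nonneg (by positivity)] at this
  linarith [le_abs_self R]

/-- **`A_s` is a `*`-hull.** [cite: LawlerSchrammWerner2003Restriction, §2 p. 8 (±-hulls)] -/
theorem isStarHull_sidePart (hs : s ≠ 0) : IsStarHull (sidePart A s) :=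
  ⟨⟨hA.isBoundedHull.1.subset (sidePart_subset A s), hA.closure_sidePart_inter hnf hs,
    hA.isSimplyConnected_diff_sidePart hnf hs⟩, fun h0 ↦ hA.zero_notMem h0.1⟩

/-- **The `+`-part `A₊ = A_1` is a `+`-hull.** [cite: LawlerSchrammWerner2003Restriction, §2 p. 8 (±-hulls)] -/
theorem isPlusHull_sidePart : IsPlusHull (sidePart A 1) :=
  ⟨hA.isStarHull_sidePart hnf one_ne_zero, fun x hx ↦ by simpa using hA.pos_of_ofReal_mem_sidePart hx⟩

/-- **The `−`-part `A₋ = A_{-1}` is a `−`-hull.** [cite: LawlerSchrammWerner2003Restriction, §2 p. 8 (±-hulls)] -/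
theorem isMinusHull_sidePart : IsMinusHull (sidePart A (-1)) :=
  ⟨hA.isStarHull_sidePart hnf (by norm_num), fun x hx ↦ by
    have := hA.pos_of_ofReal_mem_sidePart hx
    linarith⟩

/-- **The `±`-decomposition of a `*`-hull** ([LSW] §2 p. 8, topological half of
"`A = A₁ · A₂`"): a `*`-hull without floating pieces is the disjoint union of the `+`-hull
`A₊ = sidePart A 1` and the `−`-hull `A₋ = sidePart A (-1)`, each without floating pieces.
[cite: LawlerSchrammWerner2003Restriction, §2 p. 8 (±-hulls, A = A₁ · A₂)] -/
theorem sidePart_decomposition :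
    IsPlusHull (sidePart A 1) ∧ IsMinusHull (sidePart A (-1)) ∧
      sidePart A 1 ∪ sidePart A (-1) = A ∧ Disjoint (sidePart A 1) (sidePart A (-1)) ∧
      IsConnected (sidePart A 1 ∪ {z : ℂ | z.im ≤ 0}) ∧
      IsConnected (sidePart A (-1) ∪ {z : ℂ | z.im ≤ 0}) :=
  ⟨hA.isPlusHull_sidePart hnf, hA.isMinusHull_sidePart hnf, hA.sidePart_union hnf one_ne_zero,
    hA.disjoint_sidePart, isConnected_sidePart_union, isConnected_sidePart_union⟩

end IsStarHull

end Literature.Probability.RandomPlanarGeometry
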